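import Summits.SmoothPoincare4.SmoothPoincare4.Theorems.SymplecticOrigamiGromovRecognitionRelEndStubCapModelAux

/-!
# Wedge cap for `GromovRecognitionRelEnd` — the complex structure `i ⊕ i` and the inversions
(stub `stub_capModel` of line `cross-cap-laurent`, crux `SymplecticOrigami.GromovRecognitionRelEnd`,
item stmt-SmoothPoincare4-11009; second auxiliary file)

* `I4 q = (-q₁, q₀, -q₃, q₂)`, the standard complex structure `i ⊕ i` of `ℂ² = ℝ⁴` as a continuous
  linear map, `I4 ∘ I4 = -1`;
* **holomorphy of the inversions**: `d(inv1) ∘ I4 = I4 ∘ d(inv1)` off the axis (`fderiv_inv1_I4`), same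
  for `inv2` — the derivative of `1/z` is multiplication by the complex number `-1/z²`;
* the coordinate area forms `ar01 (v, w) = v₀w₁ - v₁w₀ = dx₀ ∧ dx₁`, `ar23 = dx₂ ∧ dx₃` and their
  behaviour under the inversions: `inv1^*(dx₀∧dx₁) = |z₁|⁻⁴ dx₀∧dx₁`, `inv1^*(dx₂∧dx₃) = dx₂∧dx₃`
  (`ar01_fderiv_inv1`, `ar23_fderiv_inv1`) and symmetrically for `inv2`;
* `ar01 (q, I4 q) = |q₁|²`, `ar23 (q, I4 q) = |q₂|²` (positivity behind the taming of `i ⊕ i` by the split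
  area forms).
-/

noncomputable section

-- the registered namespace `Summit.SmoothPoincare4.SmoothPoincare4.Theorems…` repeats a component
set_option linter.dupNamespace false

open scoped Manifold ContDiff Topology
open Set

namespace Summit.SmoothPoincare4.SmoothPoincare4.Theorems.GromovRecognitionRelEnd.CrossCapLaurent

namespace CapModel

/-- Model space `ℝ⁴ = ℂ²` (coordinates `0,1` = `z₁`, `2,3` = `z₂`). -/
local notation "E4" => EuclideanSpace ℝ (Fin 4)

/-! ## The complex structure `i ⊕ i` -/

/-- `i ⊕ i` as a linear map of `ℝ⁴`. [folklore] -/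
def I4ₗ : E4 →ₗ[ℝ] E4 where
  toFun q := WithLp.toLp 2 ![-(q 1), q 0, -(q 3), q 2]
  map_add' q q' := by
    ext i; fin_cases i <;> simp <;> ring
  map_smul' c q := by
    ext i; fin_cases i <;> simp

/-- **The standard complex structure `I4 = i ⊕ i`** of `ℂ² = ℝ⁴`: `I4 q = (-q₁, q₀, -q₃, q₂)` (the term
`WithLp.toLp 2 ![-(q 1), q 0, -(q 3), q 2]` of the registered signature), as a continuous linear map.
[cite: McDuffSalamon2017, §2.5] -/
def I4 : E4 →L[ℝ] E4 := LinearMap.toContinuousLinearMap I4ₗ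

/-- `I4 q` is the term of the signature. [folklore] -/
theorem I4_apply (q : E4) : I4 q = WithLp.toLp 2 ![-(q 1), q 0, -(q 3), q 2] := rfl

/-- Coordinate `0` of `I4 q`. [folklore] -/
@[simp] theorem I4_apply0 (q : E4) : I4 q 0 = -(q 1) := by simp [I4_apply]
/-- Coordinate `1` of `I4 q`. [folklore] -/
@[simp] theorem I4_apply1 (q : E4) : I4 q 1 = q 0 := by simp [I4_apply]
/-- Coordinate `2` of `I4 q`. [folklore] -/
@[simp] theorem I4_apply2 (q : E4) : I4 q 2 = -(q 3) := by simp [I4_apply]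
/-- Coordinate `3` of `I4 q`. [folklore] -/
@[simp] theorem I4_apply3 (q : E4) : I4 q 3 = q 2 := by simp [I4_apply]

/-- `I4² = -1`. [cite: McDuffSalamon2017, §2.5] -/
theorem I4_I4 (q : E4) : I4 (I4 q) = -q := by
  ext i; fin_cases i <;> simp

/-- `I4 q = 0 ↔ q = 0`. [folklore] -/
theorem I4_eq_zero_iff (q : E4) : I4 q = 0 ↔ q = 0 := by
  constructor
  · intro h
    have h2 := congrArg I4 h
    rw [I4_I4, map_zero] at h2
    exact neg_eq_zero.1 h2
  · rintro rfl; exact map_zero I4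

/-- `r1 (I4 q) = r1 q`. [folklore] -/
@[simp] theorem r1_I4 (q : E4) : r1 (I4 q) = r1 q := by simp [r1_def]; ring
/-- `r2 (I4 q) = r2 q`. [folklore] -/
@[simp] theorem r2_I4 (q : E4) : r2 (I4 q) = r2 q := by simp [r2_def]; ring

/-! ## Holomorphy of the inversions -/

/-- **`inv1` is holomorphic**: its real derivative commutes with `i ⊕ i` off the axis `z₁ = 0`.
[folklore] -/
theorem fderiv_inv1_I4 {p : E4} (h : r1 p ≠ 0) (q : E4) :
    fderiv ℝ inv1 p (I4 q) = I4 (fderiv ℝ inv1 p q) := by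
  obtain ⟨h0, h1, h2, h3⟩ := fderiv_inv1_apply h q
  obtain ⟨k0, k1, k2, k3⟩ := fderiv_inv1_apply h (I4 q)
  ext i
  fin_cases i
  · show fderiv ℝ inv1 p (I4 q) 0 = I4 (fderiv ℝ inv1 p q) 0
    simp only [k0, I4_apply0, I4_apply1, h1]; ring
  · show fderiv ℝ inv1 p (I4 q) 1 = I4 (fderiv ℝ inv1 p q) 1
    simp only [k1, I4_apply0, I4_apply1, h0]; ring
  · show fderiv ℝ inv1 p (I4 q) 2 = I4 (fderiv ℝ inv1 p q) 2
    simp only [k2, I4_apply2, h3]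
  · show fderiv ℝ inv1 p (I4 q) 3 = I4 (fderiv ℝ inv1 p q) 3
    simp only [k3, I4_apply3, h2]

/-- **`inv2` is holomorphic**: its real derivative commutes with `i ⊕ i` off the axis `z₂ = 0`.
[folklore] -/
theorem fderiv_inv2_I4 {p : E4} (h : r2 p ≠ 0) (q : E4) :
    fderiv ℝ inv2 p (I4 q) = I4 (fderiv ℝ inv2 p q) := by
  obtain ⟨h0, h1, h2, h3⟩ := fderiv_inv2_apply h q
  obtain ⟨k0, k1, k2, k3⟩ := fderiv_inv2_apply h (I4 q)
  ext i
  fin_cases i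
  · show fderiv ℝ inv2 p (I4 q) 0 = I4 (fderiv ℝ inv2 p q) 0
    simp only [k0, I4_apply0, h1]
  · show fderiv ℝ inv2 p (I4 q) 1 = I4 (fderiv ℝ inv2 p q) 1
    simp only [k1, I4_apply1, h0]
  · show fderiv ℝ inv2 p (I4 q) 2 = I4 (fderiv ℝ inv2 p q) 2
    simp only [k2, I4_apply2, I4_apply3, h3]; ring
  · show fderiv ℝ inv2 p (I4 q) 3 = I4 (fderiv ℝ inv2 p q) 3
    simp only [k3, I4_apply2, I4_apply3, h2]; ring

/-! ## The coordinate area forms and the inversions -/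

/-- `dx₀ ∧ dx₁` as a function of two vectors. [folklore] -/
def ar01 (v w : E4) : ℝ := v 0 * w 1 - v 1 * w 0

/-- `dx₂ ∧ dx₃` as a function of two vectors. [folklore] -/
def ar23 (v w : E4) : ℝ := v 2 * w 3 - v 3 * w 2

/-- Unfolding `ar01`. [folklore] -/
theorem ar01_def (v w : E4) : ar01 v w = v 0 * w 1 - v 1 * w 0 := rfl
/-- Unfolding `ar23`. [folklore] -/
theorem ar23_def (v w : E4) : ar23 v w = v 2 * w 3 - v 3 * w 2 := rfl

/-- `dx₀ ∧ dx₁ (q, I4 q) = |q₁|²`. [folklore] -/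
@[simp] theorem ar01_I4 (q : E4) : ar01 q (I4 q) = r1 q := by
  simp [ar01, r1_def]; ring
/-- `dx₂ ∧ dx₃ (q, I4 q) = |q₂|²`. [folklore] -/
@[simp] theorem ar23_I4 (q : E4) : ar23 q (I4 q) = r2 q := by
  simp [ar23, r2_def]; ring

/-- **`inv1^*(dx₀ ∧ dx₁) = |z₁|⁻⁴ dx₀ ∧ dx₁`** (the Jacobian of `z₁ ↦ 1/z₁` is `|1/z₁²|² > 0`:
orientation is preserved). [folklore] -/
theorem ar01_fderiv_inv1 {p : E4} (h : r1 p ≠ 0) (v w : E4) :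
    ar01 (fderiv ℝ inv1 p v) (fderiv ℝ inv1 p w) = (r1 p)⁻¹ ^ 2 * ar01 v w := by
  obtain ⟨h0, h1, -, -⟩ := fderiv_inv1_apply h v
  obtain ⟨k0, k1, -, -⟩ := fderiv_inv1_apply h w
  rw [ar01, h0, h1, k0, k1, ← a1_sq_add_b1_sq h, ar01]; ring

/-- `inv1^*(dx₂ ∧ dx₃) = dx₂ ∧ dx₃`. [folklore] -/
theorem ar23_fderiv_inv1 {p : E4} (h : r1 p ≠ 0) (v w : E4) :
    ar23 (fderiv ℝ inv1 p v) (fderiv ℝ inv1 p w) = ar23 v w := by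
  obtain ⟨-, -, h2, h3⟩ := fderiv_inv1_apply h v
  obtain ⟨-, -, k2, k3⟩ := fderiv_inv1_apply h w
  rw [ar23, h2, h3, k2, k3, ar23]

/-- `inv2^*(dx₀ ∧ dx₁) = dx₀ ∧ dx₁`. [folklore] -/
theorem ar01_fderiv_inv2 {p : E4} (h : r2 p ≠ 0) (v w : E4) :
    ar01 (fderiv ℝ inv2 p v) (fderiv ℝ inv2 p w) = ar01 v w := by
  obtain ⟨h0, h1, -, -⟩ := fderiv_inv2_apply h v
  obtain ⟨k0, k1, -, -⟩ := fderiv_inv2_apply h w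
  rw [ar01, h0, h1, k0, k1, ar01]

/-- **`inv2^*(dx₂ ∧ dx₃) = |z₂|⁻⁴ dx₂ ∧ dx₃`**. [folklore] -/
theorem ar23_fderiv_inv2 {p : E4} (h : r2 p ≠ 0) (v w : E4) :
    ar23 (fderiv ℝ inv2 p v) (fderiv ℝ inv2 p w) = (r2 p)⁻¹ ^ 2 * ar23 v w := by
  obtain ⟨-, -, h2, h3⟩ := fderiv_inv2_apply h v
  obtain ⟨-, -, k2, k3⟩ := fderiv_inv2_apply h w
  rw [ar23, h2, h3, k2, k3, ← a2_sq_add_b2_sq h, ar23]; ring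

/-- `|d(inv1) q|²` on the `z₁`-plane is `|z₁|⁻⁴ |q₁|²`. [folklore] -/
theorem r1_fderiv_inv1 {p : E4} (h : r1 p ≠ 0) (q : E4) :
    r1 (fderiv ℝ inv1 p q) = (r1 p)⁻¹ ^ 2 * r1 q := by
  rw [← ar01_I4, ← fderiv_inv1_I4 h, ar01_fderiv_inv1 h, ar01_I4]

/-- `|d(inv2) q|²` on the `z₂`-plane is `|z₂|⁻⁴ |q₂|²`. [folklore] -/
theorem r2_fderiv_inv2 {p : E4} (h : r2 p ≠ 0) (q : E4) :
    r2 (fderiv ℝ inv2 p q) = (r2 p)⁻¹ ^ 2 * r2 q := by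
  rw [← ar23_I4, ← fderiv_inv2_I4 h, ar23_fderiv_inv2 h, ar23_I4]

/-! ## Norm bounds used by the cap -/

/-- `‖inv1 p‖² = |z₁|⁻² + |z₂|²`. [folklore] -/
theorem norm_sq_inv1 (p : E4) : ‖inv1 p‖ ^ 2 = (r1 p)⁻¹ + r2 p := by
  rw [norm_sq_eq_r1_add_r2, r1_inv1, r2_inv1]

/-- `‖inv2 p‖² = |z₁|² + |z₂|⁻²`. [folklore] -/
theorem norm_sq_inv2 (p : E4) : ‖inv2 p‖ ^ 2 = r1 p + (r2 p)⁻¹ := by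
  rw [norm_sq_eq_r1_add_r2, r1_inv2, r2_inv2]

/-- If `|z₁|² < R₁⁻²` and `z₁ ≠ 0` then `R₁² < |1/z₁|²`. [folklore] -/
theorem sq_lt_r1_inv1 {R₁ : ℝ} {p : E4} (h0 : r1 p ≠ 0) (h : r1 p < R₁⁻¹ ^ 2) :
    R₁ ^ 2 < r1 (inv1 p) := by
  rw [r1_inv1]
  have hp : 0 < r1 p := lt_of_le_of_ne (r1_nonneg p) (Ne.symm h0)
  have := one_div_lt_one_div_of_lt hp h
  rw [one_div, one_div, inv_pow, inv_inv] at this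
  exact this

/-- If `|z₂|² < R₁⁻²` and `z₂ ≠ 0` then `R₁² < |1/z₂|²`. [folklore] -/
theorem sq_lt_r2_inv2 {R₁ : ℝ} {p : E4} (h0 : r2 p ≠ 0) (h : r2 p < R₁⁻¹ ^ 2) :
    R₁ ^ 2 < r2 (inv2 p) := by
  rw [r2_inv2]
  have hp : 0 < r2 p := lt_of_le_of_ne (r2_nonneg p) (Ne.symm h0)
  have := one_div_lt_one_div_of_lt hp h
  rw [one_div, one_div, inv_pow, inv_inv] at this
  exact this

/-- If `R₁² < |z₁|²` then `|1/z₁|² < R₁⁻²` (for `R₁ > 0`). [folklore] -/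
theorem r1_inv1_lt {R₁ : ℝ} (hR : 0 < R₁) {p : E4} (h : R₁ ^ 2 < r1 p) : r1 (inv1 p) < R₁⁻¹ ^ 2 := by
  rw [r1_inv1, inv_pow]
  exact inv_strictAnti₀ (by positivity) h

/-- If `R₁² < |z₂|²` then `|1/z₂|² < R₁⁻²` (for `R₁ > 0`). [folklore] -/
theorem r2_inv2_lt {R₁ : ℝ} (hR : 0 < R₁) {p : E4} (h : R₁ ^ 2 < r2 p) : r2 (inv2 p) < R₁⁻¹ ^ 2 := by
  rw [r2_inv2, inv_pow]
  exact inv_strictAnti₀ (by positivity) h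

/-- `R₁² < |z₁|²` forces `z₁ ≠ 0`. [folklore] -/
theorem r1_ne_zero_of_sq_lt {R₁ : ℝ} {p : E4} (h : R₁ ^ 2 < r1 p) : r1 p ≠ 0 :=
  (lt_of_le_of_lt (sq_nonneg R₁) h).ne'

/-- `R₁² < |z₂|²` forces `z₂ ≠ 0`. [folklore] -/
theorem r2_ne_zero_of_sq_lt {R₁ : ℝ} {p : E4} (h : R₁ ^ 2 < r2 p) : r2 p ≠ 0 :=
  (lt_of_le_of_lt (sq_nonneg R₁) h).ne'

/-- `R₁² < |z₁|²` gives `R₁ < ‖p‖`. [folklore] -/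
theorem lt_norm_of_sq_lt_r1 {R₁ : ℝ} {p : E4} (h : R₁ ^ 2 < r1 p) : R₁ < ‖p‖ := by
  have h2 : R₁ ^ 2 < ‖p‖ ^ 2 := lt_of_lt_of_le h (r1_le_norm_sq p)
  exact lt_of_pow_lt_pow_left₀ 2 (norm_nonneg p) h2

/-- `R₁² < |z₂|²` gives `R₁ < ‖p‖`. [folklore] -/
theorem lt_norm_of_sq_lt_r2 {R₁ : ℝ} {p : E4} (h : R₁ ^ 2 < r2 p) : R₁ < ‖p‖ := by
  have h2 : R₁ ^ 2 < ‖p‖ ^ 2 := lt_of_lt_of_le h (r2_le_norm_sq p)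
  exact lt_of_pow_lt_pow_left₀ 2 (norm_nonneg p) h2

end CapModel

/-- **Registered helper sub-goal `helper_capModelInv1Holomorphic`** (second auxiliary file of stub
`stub_capModel`): the complex inversion `(z₁, z₂) ↦ (1/z₁, z₂)` of the signature is HOLOMORPHIC for
`i ⊕ i` — its real derivative commutes with `q ↦ (-q₁, q₀, -q₃, q₂)` off the axis `z₁ = 0`.
[folklore] -/
theorem helper_capModelInv1Holomorphic : ∀ p : EuclideanSpace ℝ (Fin 4), p 0 ^ 2 + p 1 ^ 2 ≠ 0 →
    ∀ q : EuclideanSpace ℝ (Fin 4),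
    fderiv ℝ (fun x : EuclideanSpace ℝ (Fin 4) => (WithLp.toLp 2 ![x 0 / (x 0 ^ 2 + x 1 ^ 2),
      -(x 1) / (x 0 ^ 2 + x 1 ^ 2), x 2, x 3] : EuclideanSpace ℝ (Fin 4))) p
      (WithLp.toLp 2 ![-(q 1), q 0, -(q 3), q 2]) =
    WithLp.toLp 2 ![-(fderiv ℝ (fun x : EuclideanSpace ℝ (Fin 4) => (WithLp.toLp 2
        ![x 0 / (x 0 ^ 2 + x 1 ^ 2), -(x 1) / (x 0 ^ 2 + x 1 ^ 2), x 2, x 3] :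
          EuclideanSpace ℝ (Fin 4))) p q 1),
      fderiv ℝ (fun x : EuclideanSpace ℝ (Fin 4) => (WithLp.toLp 2
        ![x 0 / (x 0 ^ 2 + x 1 ^ 2), -(x 1) / (x 0 ^ 2 + x 1 ^ 2), x 2, x 3] :
          EuclideanSpace ℝ (Fin 4))) p q 0,
      -(fderiv ℝ (fun x : EuclideanSpace ℝ (Fin 4) => (WithLp.toLp 2
        ![x 0 / (x 0 ^ 2 + x 1 ^ 2), -(x 1) / (x 0 ^ 2 + x 1 ^ 2), x 2, x 3] :
          EuclideanSpace ℝ (Fin 4))) p q 3),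
      fderiv ℝ (fun x : EuclideanSpace ℝ (Fin 4) => (WithLp.toLp 2
        ![x 0 / (x 0 ^ 2 + x 1 ^ 2), -(x 1) / (x 0 ^ 2 + x 1 ^ 2), x 2, x 3] :
          EuclideanSpace ℝ (Fin 4))) p q 2] :=
  fun _ hp q => CapModel.fderiv_inv1_I4 hp q

end Summit.SmoothPoincare4.SmoothPoincare4.Theorems.GromovRecognitionRelEnd.CrossCapLaurent
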